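import Mathlib
import HarnessLib
import HarnessLib.Audit
import Summits.Langlands.Statement
import Literature.NumberTheory.GaloisRepresentations.AbsGaloisOuterConj
import Literature.NumberTheory.Automorphic.TunnellOctahedralGlobal
import Literature.NumberTheory.Automorphic.GLnAdelicStructure
import Literature.NumberTheory.GaloisRepresentations.AbsGaloisGroup
import Literature.NumberTheory.GaloisRepresentations.LocalGaloisGroup
import Literature.NumberTheory.GaloisRepresentations.GaloisRep
import Literature.NumberTheory.GaloisRepresentations.ContinuousRep
import Literature.NumberTheory.Automorphic.ReciprocityGLn
import Literature.NumberTheory.Automorphic.AutomorphicRepsGL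

/-!
Route: K3KugaSatakeDescent

CLOSED (retired) 2026-08-15T14:55:31Z by operator:999:1754322 — reason: not-a-thesis: assembly does not conclude the sub-problem Statement — note: D-0027 §2.1 audit (human 2026-08-15: routes that do not decide the summit are removed): the assembly concludes `K3SixteenProvince`, not the sub-problem statement; a NEW conforming route may be opened from the same idea (generated `closes : … → _root_.Langlands`).. The file is kept as the record of this route; refuted decls are indexed as negative knowledge (`ledger negatives`).

K3 KUGA–SATAKE DESCENT (card Langlands/Langlands/k3-sixteen-kuga-satake-descent). It suffices to
show X = "conjunct (B) of the summit restricted to the K3-SIXTEEN PROVINCE": for reciprocity data Rd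
over ℚ, every irreducible geometric ρ : Γ_ℚ → GL_6(ℚ̄_ℓ) that is exactly orthogonal, whose
determinant cuts out an IMAGINARY quadratic field E (det ρ odd), of Hodge–Tate type {−1,0,0,0,0,1}
at ℓ (transcendental motive T(X)(1) of a K3 surface of geometric Picard rank 16, the K3-part of a
Weil-type abelian fourfold, …), lying in a ℚ-rational compatible family with infinitely many
K3-ordinary companions r_p with r_p|Γ_E absolutely irreducible, corresponds at every finite place to
an L-algebraic cuspidal π of GL_6(𝔸_ℚ). Lean: decl `K3SixteenProvince` of this route (one line over
ReciprocityData, IsGeometricFramed, Corresponds, CuspidalAutomorphicRepData, FramedGaloisRep,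
HasQlModel, PeriodRingData.hodgeTateWeights, absGaloisRestrict); `ProvinceOfSummit` records that X
is a literal restriction of `GaloisToAutomorphic 6 Rd hcpt`. Mechanism: through the exceptional
isogeny D_3 = A_3 (PSO_6 = PGL_4) the orthogonal ρ lifts over E to a POLARIZED W : Γ_E → GL_4 with
doubled weights {0,0,1,1} at both embeddings (H^1 of a Weil-type fourfold), whose archimedean
parameter on U_E(2,2) is a NON-DEGENERATE limit of discrete series; automorphy of W is a BCGP-shaped
lifting problem (higher Hida theory on U(2,2) + Calegari–Geraghty patching + a residual anchor), and
Kim's exterior square GL_4 → GL_6 with Arthur–Clozel quadratic descent returns the answer to GL_6/ℚ.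

Rationale: WHY THIS LINE. BCGP (BoxerEtAl2021) made abelian surfaces — the B_2 = C_2 rung: 5-dim orthogonal
motives of K3 type = Picard rank 17 — potentially modular by patching higher Hida complexes
(Pilloni2020) of the irregular weight (2,2) on GSp_4. One rung up, rank-6 K3-type motives (Picard
rank 16, Weil-type fourfolds: Lombardo2001, Vangeemen2023) pass through D_3 = A_3: the spin lift
over the determinant field E is a polarized GL_4/E representation with doubled Hodge–Tate weights,
hosted by the 4-dimensional U(2,2) Shimura variety (itself the period space of these motives). Kill
test (F2) of the card, run on paper before opening: with K = U(2)×U(2), compact roots ±(e1−e2),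
±(e3−e4), the parameter λ = (1/2,−1/2 | 1/2,−1/2) of infinitesimal character (1/2,1/2,−1/2,−1/2) is
non-singular on every compact root and singular only on non-compact ones: the packet consists of
NON-DEGENERATE limits of discrete series (Knapp1986 Thm 12.26; Harris 1990 coherent realisation) —
the card survives. Correction found while typing: the province is the ODD-determinant sector only
(det ρ(c) = −1); for det ρ = 1 the spin lift is a non-self-dual GL_4/ℚ representation and no unitary
host exists; for det even-nontrivial E is real quadratic (the quadratic-window cards). Imported:
Kuga–Satake/D_3=A_3 dictionary (Hodge theory), Tate–Patrikis lifting (Patrikis2019), BCGP engine,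
Kim2002 + ArthurClozelAMS120 functoriality; statements typed in the tree's Galois/GL_n language (no
unitary groups in Lean: U(2,2) lives inside the cruxes' proofs, never in their statements).
Ordinarity is typed datum-free as a (1,4,1) resp. (2,2) flag with cyclotomic graded pieces on an
open part of inertia, which is what makes the E-level cruxes independent of the placeholder p-adic
Hodge datum.
RANKED CRUXES. (2) DoubledWeightLifting — automorphy lifting over imaginary quadratic E for
absolutely irreducible, τ-polarized, weight-{0,0,1,1}² ordinary W congruent to an automorphic W₁ of
the same type: BCGP on U(2,2) (higher Hida at the singular weight + CG patching in defect = length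
of the coherent range). (3) SerreTypeAnchor — in an infinite ordinary family of such avatars some
prime carries an automorphic congruent W₁ (residual automorphy: CM/induced congruences, the p = 2
coincidence U_4(2) ≅ PSp_4(3) with modularity of abelian surfaces, or Moret-Bailly on twisted U(2,2)
Shimura varieties — only the potential version has a template). (4) LocalGlobalUpgrade — from Satake
matching a.e. to `Corresponds` at ALL places incl. ℓ for an irregular π on GL_6/ℚ (local–global
compatibility of (A)-type for limit-of-discrete-series forms). Support: SpinAvatar (the D_3 = A_3
dictionary with ordinarity/irreducibility transfer; Tate–Patrikis), EvenSectorNotPolarized (the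
wall: for det ρ = 1 the spin lift lives over ℚ and is not essentially self-dual — no unitary host),
WedgeSquareDescent (Kim Λ² + AC descent read on the Galois side; antecedent = the tree's named fact
cuspidal_descent_cyclic), WeakProvince, UpgradeUnderA (LocalGlobalUpgrade follows from direction (A)
for GL_6/ℚ by Brauer–Nesbitt — provable glue showing crux (4) is the (A)-residue), ProvinceOfSummit.
Assembly = SpinAvatar → SerreTypeAnchor → DoubledWeightLifting → WedgeSquareDescent →
LocalGlobalUpgrade → K3SixteenProvince (glue: choice of an odd ordinary prime in the class's
infinite set, Chebotarev/Brauer–Nesbitt transfer of Satake matching through the rational family; all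
cone facts used are proved: HasFrobCharpolyAt.unique_holds, chebotarev_artinRep_holds,
isCompact_glFiniteIntegralLevel_holds).
KILL CRITERIA. (i) A member of the U(2,2) LDS packet analysis showing NO coherent cohomological
realisation in a degree range of length ≤ 2 kills DoubledWeightLifting's intended proof (route
survives only as a statement of (B)). (ii) A certified K3/ℚ of Picard rank 16 with det ρ_T odd whose
ordinary avatar is residually automorphic at no prime ≤ some bound does not refute but starves
SerreTypeAnchor; a proof that weight-{0,0,1,1} ordinary polarized mod-p classes on GU(2,2) need not
lift to characteristic 0 in that weight refutes it. (iii) ¬LocalGlobalUpgrade via an explicit pair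
(π, ρ) with matching Satake data and WD(ρ|Γ_v) ≠ rec(π_v) at a ramified v. (iv) Any refutation of
SpinAvatar at p = 3,5 (linear algebra) means the dictionary is mis-typed — repair, not close.
NOT DECOMPOSED YET (earned by splits later): higher Hida theory for U(2,2) at the doubled weight
(perfect ordinary complex of length ≤ 2 over the Iwasawa algebra, classicity in regular weights) and
the CG patching argument are the two natural children of DoubledWeightLifting; residual
adequacy/p-distinguishedness hypotheses (no residual-image predicate for ℓ-adic reps in the tree yet
— definition requested) will enter as a child restatement; the clients census (a certified rank-16
K3/ℚ with odd det ρ_T, its ordinary primes and zeta functions; van Geemen's Weil fourfolds) is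
deliberately left to a computation item; the rank-3 U(2,1) sibling (Picard curves) is route
PicardBranchPoint's, the symplectic (1,2,2,1) rung is route GSpinRung's, and the rank-5/U(4,1)
occult province is route CubicSurfaceE6Transport's — this route shares only the BCGP engine family
with them.

Novelty: Nearest prior art (searched: lit frontier Langlands --since 2021, lit bridges Langlands --cross any,
crossref 'Elsenhans Jahnel characteristic polynomial Frobenius', galaxy --star all 'fourfolds of
Weil type'/'Weil type' (noise only), plus the card's own zbMATH/crossref sweep graded by
refuter-novelty-audit-8): ENGINE = BoxerEtAl2021 (BCGP, GSp_4 weight (2,2)) with Pilloni2020 higher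
Hida theory, GoldringKoskivirta2019 (Galois representations for LDS/coherent forms),
CalegariGeraghty2017; DICTIONARY = Lombardo2001 (Weil-type abelian varieties as Kuga–Satake
varieties of rank-6 K3-type Hodge structures), arXiv:1209.5997 Lombardo–Peters–Schütt (Picard rank
16 double planes ↔ Weil fourfolds / U(2,2) ball-type domain), Vangeemen2023 (spinor map, D_3 = A_3);
CLOSING = Kim2002 (Λ²: GL_4 → GL_6) + ArthurClozelAMS120. Newest neighbour found: arXiv:2602.04778
(2026, R = T for orthogonal Shimura varieties) treats REGULAR self-dual representations over totally
real fields in defect zero — the opposite corner (regular weight, orthogonal host) from this route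
(irregular K3 weight, unitary host via the spin lift). No source proposes automorphy of
Picard-rank-16 K3 / odd-determinant Weil-type motives via non-degenerate LDS on U(2,2) +
positive-defect patching, nor types the province. DELTA over the card: (a) the sector correction —
only the ODD-determinant half of rank-16 K3 motives is U(2,2)-hosted (pure group theory: O_6 ∖ SO_6
acts on PGL_4 = PSO_6 by the outer automorphism, so the spin  [refs: 1209.5997, 2602.04778, BoxerEtAl2021, Pilloni2020, GoldringKoskivirta2019, CalegariGeraghty2017, Lombardo2001, Vangeemen2023, Kim2002]

Barriers (technique_class: taylor-wiles coherent-cohomology kuga-satake-descent): technique_class: taylor-wiles coherent-cohomology kuga-satake-descent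
- Literature.Barriers.Langlands.NonRegularWeightBarrier: ENGAGED and evaded as in BCGP — the
automorphic objects are non-regular (limits of discrete series) but NON-DEGENERATE, hence realised
in coherent cohomology of the U(2,2) Shimura variety in a range of degrees where higher Hida/Coleman
theory interpolates; the barrier's proved kernel (Betti realisation needs regular infinitesimal
character; the tree's exists_galoisRep_of_regularAlgebraic assumes IsRegularAlgebraic) is respected:
no Betti cohomology is used. Crux LocalGlobalUpgrade is exactly the residue of this barrier on the
(A)-side (LGC for LDS forms) and is filed as a crux, not assumed.
- Literature.Barriers.Langlands.TaylorWilesNumericalCoincidence and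
Literature.Barriers.Langlands.TaylorWilesNumericalCoincidenceNarrow: ENGAGED — the coincidence fails
by the defect l = length of the coherent degree range of the LDS packet; evaded by Calegari–Geraghty
patching of a length-l ordinary complex (CalegariGeraghty2017, BoxerEtAl2021), never by defect-zero
R = T; DoubledWeightLifting is stated as the lifting OUTPUT so that either patching flavour may
prove it.
- Literature.Barriers.Langlands.ResiduallyReducibleBarrier: NOT evaded — residual bigness is a
per-client hypothesis; the typed class demands absolute irreducibility of the companions r_p|Γ_E
(ℓ-adically; Cadoret–Moonen-type open-image results supply the residual version for K3 clients at p
≫ 0), a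

History (route lifecycle, newest last):
- 2026-08-15T12:32:30Z · BROKEN — SerreTypeAnchor (stmt-Langlands-3797, crux) refuted by Summit.Langlands.Langlands.Theorems.K3KugaSatakeDescentSerreTypeAnchor_refuted (refuter-refute-pool-g41-9)
- 2026-08-15T14:44:31Z · BROKEN — SerreTypeAnchor (stmt-Langlands-3797, crux) refuted by Summit.Langlands.Langlands.Theorems.K3KugaSatakeDescentSerreTypeAnchor_refuted (gate)
- 2026-08-15T14:55:31Z · CLOSED retired — not-a-thesis: assembly does not conclude the sub-problem Statement (operator:999:1754322)

sub-problem: Langlands · status: closed(retired) · opened planner-plancard-Langlands-Langlands-k3-sixte-3e6adcd7-0 2026-08-15T11:24:28Z · rev 1 · ledger route-Langlands-K3KugaSatakeDescent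
GENERATED by the gate from the ledger (D-0016/17). Provers cite these decls: `theorem foo : Summit.Langlands.Langlands.Theses.K3KugaSatakeDescent.<Decl> := …` in Summits/Langlands/Langlands/Theorems/<Name>.lean.
-/

namespace Summit.Langlands.Langlands.Theses.K3KugaSatakeDescent

open scoped BigOperators Topology Manifold Classical MeasureTheory ProbabilityTheory Matrix InnerProductSpace ComplexConjugate ContinuousMap
open Filter Set Function TopologicalSpace MeasureTheory

attribute [summit_statement] _root_.Langlands

open Literature.NumberTheory.Automorphic Literature.NumberTheory.GaloisRepresentations Literature.NumberTheory.GaloisRepresentations.IsFrobPow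

/-- item stmt-Langlands-3795 · target · rank 0 · closed · moot by None · by planner
why it might fail: Stronger than the motivic intent only through abstract ρ in the typed class; inherits the placeholder PstWeilDeligneData (∀ Rd): for the genuine datum it is (B) on the province, refutable only with (B) itself.
sources: BoxerEtAl2021, Lombardo2001, Vangeemen2023, arXiv:1209.5997, BuzzardGeeLMS2014
[target] X = conjunct (B) restricted to the K3-sixteen province: for every reciprocity datum Rd over
ℚ (parametrised exactly like GaloisToAutomorphic 6 Rd hcpt; see ProvinceOfSummit), every imaginary
quadratic Galois E with τ ∉ res(Γ_E), and every ρ : Γ_ℚ → GL_6(ℚ̄_ℓ) that is irreducible, geometric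
(Rd), EXACTLY orthogonal (ρᵀJρ = J, J symmetric invertible), with det ρ trivial on Γ_E and det ρ(τ)
= −1 (odd-determinant sector: E = determinant field), of Hodge–Tate type {−1,0,0,0,0,1} at ℓ (read
through Rd.pst on a finite E/ℚ_ℓ-model, multiplicities × [L:ℚ_ℓ]; Buzzard–Gee sign convention of
PAdicHodge), and lying in a ℚ-rational compatible family (bad, P) — Frobenius char. polys P(v) ∈
ℚ[X] away from bad ∪ {ℓ} — admitting at infinitely many primes p a companion r_p (same P) that is
orthogonal, has the same determinant field, is K3-ORDINARY at p (conjugate to a (1,4,1)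
block-upper-triangular representation of Γ_{ℚ_p} with graded pieces ε | unramified | ε⁻¹ on an open
subgroup of inertia) and has r_p|Γ_E absolutely irreducible: there is an L-algebraic cuspidal π of
GL_6(𝔸_ℚ) with Corresponds Rd ι π ρ. Clients: T(X)(1) for X/ℚ a K3 surface of geometric Picard rank
16 with det ρ_T odd (o -/
@[route_item "route-Langlands-K3KugaSatakeDescent"]
def K3SixteenProvince : Prop :=
  ∀ (Rd : ReciprocityData ℚ) (hcpt : isCompact_glFiniteIntegralLevel 6 ℚ) (ℓ : ℕ) [Fact ℓ.Prime] (ι : PadicAlgCl ℓ ≃+* ℂ), ∀ (E : Type) [Field E] [NumberField E] [IsGalois ℚ E] [NumberField.IsTotallyComplex E], Module.finrank ℚ E = 2 → ∀ (τ : Field.absoluteGaloisGroup ℚ), τ ∉ Set.range (absGaloisRestrict ℚ E) → ∀ (ρ : FramedGaloisRep ℚ (PadicAlgCl ℓ) 6), ρ.toGaloisRep.IsIrreducible → IsGeometricFramed Rd ρ → (∃ J : Matrix (Fin 6) (Fin 6) (PadicAlgCl ℓ), J.IsSymm ∧ IsUnit J ∧ ∀ σ, ((ρ σ : GL (Fin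 6) (PadicAlgCl ℓ)) : Matrix (Fin 6) (Fin 6) (PadicAlgCl ℓ))ᵀ * J * ((ρ σ : GL (Fin 6) (PadicAlgCl ℓ)) : Matrix (Fin 6) (Fin 6) (PadicAlgCl ℓ)) = J) → (∀ σ : Field.absoluteGaloisGroup E, FramedRep.det ρ (absGaloisRestrict ℚ E σ) = 1) ∧ FramedRep.det ρ τ = -1 → (∀ (v : IsDedekindDomain.HeightOneSpectrum (NumberField.RingOfIntegers ℚ)) (hv : ((ℓ : ℕ) : NumberField.RingOfIntegers ℚ) ∈ v.asIdeal), ∃ (L : IntermediateField ℚ_[ℓ] (PadicAlgCl ℓ)) (_ : FiniteDimensional ℚ_[ℓ] L) (rL : FramedGaloisRep (v.adicCompletion ℚ) L 6), HasQlModel (ρ.toLocal v) L rL ∧ (letI := (Rd.pst ℓ v hv).algebra; (Rd.pst ℓ v hv).𝔅.hodgeTateWeights (restrictScalarsQl L rL) = Module.finrank ℚ_[ℓ] L • ({-1, 0, 0, 0, 0, 1} : Multiset ℤ))) → ∀ (bad : Finset (IsDedekindDomain.HeightOneSpectrum (NumberField.RingOfIntegers ℚ))) (P : IsDedekindDomain.HeightOneSpectrum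 (NumberField.RingOfIntegers ℚ) → Polynomial ℚ), (∀ v ∉ bad, ((ℓ : ℕ) : NumberField.RingOfIntegers ℚ) ∉ v.asIdeal → ρ.IsUnramifiedAt v ∧ ρ.HasFrobCharpolyAt v ((P v).map (algebraMap ℚ (PadicAlgCl ℓ)))) → {p : ℕ | ∃ (_ : Fact p.Prime) (r : FramedGaloisRep ℚ (PadicAlgCl p) 6), (∀ v ∉ bad, ((p : ℕ) : NumberField.RingOfIntegers ℚ) ∉ v.asIdeal → r.IsUnramifiedAt v ∧ r.HasFrobCharpolyAt v ((P v).map (algebraMap ℚ (PadicAlgCl p)))) ∧ (∃ J : Matrix (Fin 6) (Fin 6) (PadicAlgCl p), J.IsSymm ∧ IsUnit J ∧ ∀ σ, ((r σ : GL (Fin 6) (PadicAlgCl p)) : Matrix (Fin 6) (Fin 6) (PadicAlgCl p))ᵀ * J * ((r σ : GL (Fin 6) (PadicAlgCl p)) : Matrix (Fin 6) (Fin 6) (PadicAlgCl p)) = J) ∧ (∀ σ : Field.absoluteGaloisGroup E, FramedRep.det r (absGaloisRestrict ℚ E σ) = 1) ∧ FramedRep.det r τ = -1 ∧ (∀ (v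 : IsDedekindDomain.HeightOneSpectrum (NumberField.RingOfIntegers ℚ)), ((p : ℕ) : NumberField.RingOfIntegers ℚ) ∈ v.asIdeal → ∃ (g : GL (Fin 6) (PadicAlgCl p)) (U : OpenSubgroup (Field.absoluteGaloisGroup (v.adicCompletion ℚ))), (∀ (σ : Field.absoluteGaloisGroup (v.adicCompletion ℚ)) (i j : Fin 6), ((1 ≤ i.val ∧ j.val = 0) ∨ (i.val = 5 ∧ j.val ≤ 4)) → ((g * r.toLocal v σ * g⁻¹ : GL (Fin 6) (PadicAlgCl p)) : Matrix (Fin 6) (Fin 6) (PadicAlgCl p)) i j = 0) ∧ (∀ σ ∈ absInertia (v.adicCompletion ℚ), σ ∈ U → (∀ i j : Fin 6, (1 ≤ i.val ∧ i.val ≤ 4 ∧ 1 ≤ j.val ∧ j.val ≤ 4) → ((g * r.toLocal v σ * g⁻¹ : GL (Fin 6) (PadicAlgCl p)) : Matrix (Fin 6) (Fin 6) (PadicAlgCl p)) i j = if i = j then 1 else 0) ∧ ((g * r.toLocal v σ * g⁻¹ : GL (Fin 6) (PadicAlgCl p)) : Matrix (Fin 6) (Fin 6) (PadicAlgCl p))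 0 0 = algebraMap ℚ_[p] (PadicAlgCl p) ((GaloisRep.cyclotomicCharacter (v.adicCompletion ℚ) p σ : ℤ_[p]ˣ) : ℤ_[p]) ∧ ((g * r.toLocal v σ * g⁻¹ : GL (Fin 6) (PadicAlgCl p)) : Matrix (Fin 6) (Fin 6) (PadicAlgCl p)) 5 5 = (algebraMap ℚ_[p] (PadicAlgCl p) ((GaloisRep.cyclotomicCharacter (v.adicCompletion ℚ) p σ : ℤ_[p]ˣ) : ℤ_[p]))⁻¹)) ∧ FramedRep.IsAbsolutelyIrreducible (r.restrictField E)}.Infinite → ∃ π : CuspidalAutomorphicRepData 6 ℚ hcpt, π.1.IsLAlgebraic ∧ Corresponds Rd ι π.1 ρ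

/-- item stmt-Langlands-3796 · crux · rank 2 · closed · moot by None · by planner
why it might fail: λ=(1/2,−1/2|1/2,−1/2) lies on TWO noncompact walls: the 4 n.d.LDS fill coherent degrees 1,2,2,3 of the U(2,2) fourfold (no H⁰ member; CG defect l₀=2 vs BCGP's 0–1, l₀=1); no integral higher Hida theory for GU(2,2) in print; the typed statement omits residual bigness/p-distinguishedness of W̄.
sources: BoxerEtAl2021, Pilloni2020, BoxerPilloni2021HigherColeman, BoxerPilloni2025, CalegariGeraghty2017, GoldringKoskivirta2019
[crux, rank 2 — the engine: BCGP on U(2,2)] For E imaginary quadratic Galois, τ ∈ Γ_ℚ ∖ res(Γ_E), p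
prime, ι : ℚ̄_p ≅ ℂ, and W, W₁ : Γ_E → GL_4(ℚ̄_p): if W is absolutely irreducible, τ-POLARIZED (tr
W^τ(σ) = χ(σ) tr W(σ⁻¹), i.e. W^c ≅ W^∨ ⊗ χ), ORDINARY OF WEIGHT {0,0,1,1} at every w ∣ p (conjugate
to a (2,2) block-upper-triangular representation of Γ_{E_w} whose diagonal blocks are trivial resp.
ε⁻¹·Id on an open subgroup of inertia — potentially semistable ordinary, H¹-of-Weil-fourfold shape),
unramified a.e., and CONGRUENT (all char. poly coefficients within p-adic distance < 1) to a
τ-polarized, same-shape-ordinary W₁ that is automorphic (Satake–Frobenius matching a.e. with an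
L-algebraic cuspidal Π₁ of GL_4(𝔸_E)), then W is automorphic in the same sense. Intended proof = the
card's K1+K2: higher Hida theory for GU(2,2) at the singular weight attached to HT {0,0,1,1}²
(ordinary part of RΓ(Sh^tor, V_κ(−D)) perfect of amplitude ≤ 2 over the Iwasawa algebra, classical
in regular weights; Pilloni2020 transplanted, Boxer–Pilloni arXiv:2110.10251 for the finite-slope
template), Goldring–Koskivirta Galois representations at classical LDS points,
Calegari–Geraghty/BCGP patching in defe -/
@[route_item "route-Langlands-K3KugaSatakeDescent"]
def DoubledWeightLifting : Prop :=
  ∀ (E : Type) [Field E] [NumberField E] [IsGalois ℚ E] [NumberField.IsTotallyComplex E], Module.finrank ℚ E = 2 → ∀ (τ : Field.absoluteGaloisGroup ℚ), τ ∉ Set.range (absGaloisRestrict ℚ E) → ∀ (hcptE : isCompact_glFiniteIntegralLevel 4 E) (p : ℕ) [Fact p.Prime] (ι : PadicAlgCl p ≃+* ℂ) (W W₁ : FramedGaloisRep E (PadicAlgCl p) 4), FramedRep.IsAbsolutelyIrreducible W → (∃ χ : Field.absoluteGaloisGroup E →ₜ* (PadicAlgCl p)ˣ, ∀ σ, FramedRep.trace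 (FramedGaloisRep.outerConj τ W) σ = (χ σ : PadicAlgCl p) * FramedRep.trace W σ⁻¹) → (∀ (w : IsDedekindDomain.HeightOneSpectrum (NumberField.RingOfIntegers E)), ((p : ℕ) : NumberField.RingOfIntegers E) ∈ w.asIdeal → ∃ (g : GL (Fin 4) (PadicAlgCl p)) (U : OpenSubgroup (Field.absoluteGaloisGroup (w.adicCompletion E))), (∀ (σ : Field.absoluteGaloisGroup (w.adicCompletion E)) (i j : Fin 4), (2 ≤ i.val ∧ j.val ≤ 1) → ((g * W.toLocal w σ * g⁻¹ : GL (Fin 4) (PadicAlgCl p)) : Matrix (Fin 4) (Fin 4) (PadicAlgCl p)) i j = 0) ∧ (∀ σ ∈ absInertia (w.adicCompletion E), σ ∈ U → ∀ i j : Fin 4, ((i.val ≤ 1 ∧ j.val ≤ 1) → ((g * W.toLocal w σ * g⁻¹ : GL (Fin 4) (PadicAlgCl p)) : Matrix (Fin 4) (Fin 4) (PadicAlgCl p)) i j = if i = j then 1 else 0) ∧ ((2 ≤ i.val ∧ 2 ≤ j.val) → ((g * W.toLocal w σ * g⁻¹ : GL (Fin 4) (PadicAlgCl p)) : Matrix (Fin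 4) (Fin 4) (PadicAlgCl p)) i j = if i = j then (algebraMap ℚ_[p] (PadicAlgCl p) ((GaloisRep.cyclotomicCharacter (w.adicCompletion E) p σ : ℤ_[p]ˣ) : ℤ_[p]))⁻¹ else 0))) → (∀ᶠ w : IsDedekindDomain.HeightOneSpectrum (NumberField.RingOfIntegers E) in Filter.cofinite, W.IsUnramifiedAt w) → (∃ χ : Field.absoluteGaloisGroup E →ₜ* (PadicAlgCl p)ˣ, ∀ σ, FramedRep.trace (FramedGaloisRep.outerConj τ W₁) σ = (χ σ : PadicAlgCl p) * FramedRep.trace W₁ σ⁻¹) → (∀ (w : IsDedekindDomain.HeightOneSpectrum (NumberField.RingOfIntegers E)), ((p : ℕ) : NumberField.RingOfIntegers E) ∈ w.asIdeal → ∃ (g : GL (Fin 4) (PadicAlgCl p)) (U : OpenSubgroup (Field.absoluteGaloisGroup (w.adicCompletion E))), (∀ (σ : Field.absoluteGaloisGroup (w.adicCompletion E)) (i j : Fin 4), (2 ≤ i.val ∧ j.val ≤ 1) → ((g * W₁.toLocal w σ * g⁻¹ : GL (Fin 4) (PadicAlgCl p)) : Matrix (Fin 4) (Fin 4) (PadicAlgCl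 p)) i j = 0) ∧ (∀ σ ∈ absInertia (w.adicCompletion E), σ ∈ U → ∀ i j : Fin 4, ((i.val ≤ 1 ∧ j.val ≤ 1) → ((g * W₁.toLocal w σ * g⁻¹ : GL (Fin 4) (PadicAlgCl p)) : Matrix (Fin 4) (Fin 4) (PadicAlgCl p)) i j = if i = j then 1 else 0) ∧ ((2 ≤ i.val ∧ 2 ≤ j.val) → ((g * W₁.toLocal w σ * g⁻¹ : GL (Fin 4) (PadicAlgCl p)) : Matrix (Fin 4) (Fin 4) (PadicAlgCl p)) i j = if i = j then (algebraMap ℚ_[p] (PadicAlgCl p) ((GaloisRep.cyclotomicCharacter (w.adicCompletion E) p σ : ℤ_[p]ˣ) : ℤ_[p]))⁻¹ else 0))) → (∀ (σ : Field.absoluteGaloisGroup E) (i : ℕ), ‖(FramedRep.charpoly W σ).coeff i - (FramedRep.charpoly W₁ σ).coeff i‖ < 1) → (∃ πE : CuspidalAutomorphicRepData 4 E hcptE, πE.1.IsLAlgebraic ∧ ∀ᶠ w : IsDedekindDomain.HeightOneSpectrum (NumberField.RingOfIntegers E) in Filter.cofinite, SatakeFrobCompatibleAt ι πE.1 W₁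 w) → (∃ πE : CuspidalAutomorphicRepData 4 E hcptE, πE.1.IsLAlgebraic ∧ ∀ᶠ w : IsDedekindDomain.HeightOneSpectrum (NumberField.RingOfIntegers E) in Filter.cofinite, SatakeFrobCompatibleAt ι πE.1 W w)

/-- item stmt-Langlands-3797 · crux · rank 3 · closed · refuted by Summit.Langlands.Langlands.Theorems.K3KugaSatakeDescentSerreTypeAnchor_refuted (refuter) · by planner
why it might fail: Serre-type residual automorphy for polarized weight-{0,0,1,1}² ordinary reps over E: no theorem for U(2,2), no template beyond GSp4 (BCGP); S is an ARBITRARY infinite set, so the p=2,3 coincidences (U4(2)≅PSp4(3)) may miss S, and ordinary automorphic lifts of this singular weight may not exist.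
sources: BoxerEtAl2021, BoxerCalegariGeePilloni2025, arXiv:1209.5997, Taylor2006, BarnetlambEtAl2014, Calegari2023
[crux, rank 3 — the residual anchor] For E, τ as above, a ℚ-rational family datum (bad, P) and an
INFINITE set S of primes: given for each p ∈ S a companion r_p : Γ_ℚ → GL_6(ℚ̄_p) matching P away
from bad ∪ {p} and an avatar W_p : Γ_E → GL_4(ℚ̄_p) with Λ²W_p ≅ ν_p ⊗ r_p|Γ_E (trace identity), W_p
absolutely irreducible, τ-polarized, weight-{0,0,1,1} ordinary at p, unramified a.e. — there is SOME
p ∈ S and an automorphic (for some ι₀; Satake matching a.e. with an L-algebraic cuspidal Π₁ on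
GL_4/E), τ-polarized, same-shape ordinary W₁ congruent to W_p. This is residual automorphy in
disguise (take W₁ = an ordinary automorphic lift of W̄_p of the prescribed p-adic Hodge type) and is
the one step with no template: BCGP anchored abelian surfaces at p = 3 through GSp_4(F_3) and a 2-3
switch. Lines of attack recorded for provers/refuters: (a) the coincidence U_4(2) ≅ PSp_4(3) (order
25920): the mod-2 unitary residual representation of a Weil-type fourfold has the shape of the mod-3
representation of an abelian surface, now known modular over ℚ (BCGP 2025) — a 2-adic anchor if an
ordinary weight-{0,0,1,1} lift of the transferred form exists; (b) E = ℚ(i), Kummer/six-lines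
degeneration (reti -/
@[route_item "route-Langlands-K3KugaSatakeDescent"]
def SerreTypeAnchor : Prop :=
  ∀ (E : Type) [Field E] [NumberField E] [IsGalois ℚ E] [NumberField.IsTotallyComplex E], Module.finrank ℚ E = 2 → ∀ (τ : Field.absoluteGaloisGroup ℚ), τ ∉ Set.range (absGaloisRestrict ℚ E) → ∀ (bad : Finset (IsDedekindDomain.HeightOneSpectrum (NumberField.RingOfIntegers ℚ))) (P : IsDedekindDomain.HeightOneSpectrum (NumberField.RingOfIntegers ℚ) → Polynomial ℚ) (S : Set ℕ), S.Infinite → ∀ (rf : ∀ (p : ℕ) [Fact p.Prime], FramedGaloisRep ℚ (PadicAlgCl p) 6) (Wf : ∀ (p : ℕ) [Fact p.Prime], FramedGaloisRep E (PadicAlgCl p) 4), (∀ (p : ℕ) [Fact p.Prime], p ∈ S → (∀ v ∉ bad, ((p : ℕ) : NumberField.RingOfIntegers ℚ) ∉ v.asIdeal → (rf p).IsUnramifiedAt v ∧ (rf p).HasFrobCharpolyAt v ((P v).map (algebraMap ℚ (PadicAlgCl p)))) ∧ (∃ ν : Field.absoluteGaloisGroup E →ₜ* (PadicAlgCl p)ˣ,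 ∀ σ : Field.absoluteGaloisGroup E, (ν σ : PadicAlgCl p) * FramedRep.trace (rf p) (absGaloisRestrict ℚ E σ) = ((FramedRep.trace (Wf p) σ) ^ 2 - FramedRep.trace (Wf p) (σ * σ)) / 2) ∧ FramedRep.IsAbsolutelyIrreducible (Wf p) ∧ (∃ χ : Field.absoluteGaloisGroup E →ₜ* (PadicAlgCl p)ˣ, ∀ σ, FramedRep.trace (FramedGaloisRep.outerConj τ (Wf p)) σ = (χ σ : PadicAlgCl p) * FramedRep.trace (Wf p) σ⁻¹) ∧ (∀ (w : IsDedekindDomain.HeightOneSpectrum (NumberField.RingOfIntegers E)), ((p : ℕ) : NumberField.RingOfIntegers E) ∈ w.asIdeal → ∃ (g : GL (Fin 4) (PadicAlgCl p)) (U : OpenSubgroup (Field.absoluteGaloisGroup (w.adicCompletion E))), (∀ (σ : Field.absoluteGaloisGroup (w.adicCompletion E)) (i j : Fin 4), (2 ≤ i.val ∧ j.val ≤ 1) → ((g * (Wf p).toLocal w σ * g⁻¹ : GL (Fin 4) (PadicAlgCl p)) : Matrix (Fin 4) (Fin 4) (PadicAlgCl p)) i j = 0) ∧ (∀ σ ∈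 absInertia (w.adicCompletion E), σ ∈ U → ∀ i j : Fin 4, ((i.val ≤ 1 ∧ j.val ≤ 1) → ((g * (Wf p).toLocal w σ * g⁻¹ : GL (Fin 4) (PadicAlgCl p)) : Matrix (Fin 4) (Fin 4) (PadicAlgCl p)) i j = if i = j then 1 else 0) ∧ ((2 ≤ i.val ∧ 2 ≤ j.val) → ((g * (Wf p).toLocal w σ * g⁻¹ : GL (Fin 4) (PadicAlgCl p)) : Matrix (Fin 4) (Fin 4) (PadicAlgCl p)) i j = if i = j then (algebraMap ℚ_[p] (PadicAlgCl p) ((GaloisRep.cyclotomicCharacter (w.adicCompletion E) p σ : ℤ_[p]ˣ) : ℤ_[p]))⁻¹ else 0))) ∧ (∀ᶠ w : IsDedekindDomain.HeightOneSpectrum (NumberField.RingOfIntegers E) in Filter.cofinite, (Wf p).IsUnramifiedAt w)) → ∃ p ∈ S, ∃ (_ : Fact p.Prime) (W₁ : FramedGaloisRep E (PadicAlgCl p) 4), (∃ χ : Field.absoluteGaloisGroup E →ₜ* (PadicAlgCl p)ˣ, ∀ σ, FramedRep.trace (FramedGaloisRep.outerConj τ W₁) σ = (χ σ : PadicAlgCl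 p) * FramedRep.trace W₁ σ⁻¹) ∧ (∀ (w : IsDedekindDomain.HeightOneSpectrum (NumberField.RingOfIntegers E)), ((p : ℕ) : NumberField.RingOfIntegers E) ∈ w.asIdeal → ∃ (g : GL (Fin 4) (PadicAlgCl p)) (U : OpenSubgroup (Field.absoluteGaloisGroup (w.adicCompletion E))), (∀ (σ : Field.absoluteGaloisGroup (w.adicCompletion E)) (i j : Fin 4), (2 ≤ i.val ∧ j.val ≤ 1) → ((g * W₁.toLocal w σ * g⁻¹ : GL (Fin 4) (PadicAlgCl p)) : Matrix (Fin 4) (Fin 4) (PadicAlgCl p)) i j = 0) ∧ (∀ σ ∈ absInertia (w.adicCompletion E), σ ∈ U → ∀ i j : Fin 4, ((i.val ≤ 1 ∧ j.val ≤ 1) → ((g * W₁.toLocal w σ * g⁻¹ : GL (Fin 4) (PadicAlgCl p)) : Matrix (Fin 4) (Fin 4) (PadicAlgCl p)) i j = if i = j then 1 else 0) ∧ ((2 ≤ i.val ∧ 2 ≤ j.val) → ((g * W₁.toLocal w σ * g⁻¹ : GL (Fin 4) (PadicAlgCl p)) : Matrix (Fin 4) (Fin 4) (PadicAlgCl p))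 i j = if i = j then (algebraMap ℚ_[p] (PadicAlgCl p) ((GaloisRep.cyclotomicCharacter (w.adicCompletion E) p σ : ℤ_[p]ˣ) : ℤ_[p]))⁻¹ else 0))) ∧ (∀ (σ : Field.absoluteGaloisGroup E) (i : ℕ), ‖(FramedRep.charpoly (Wf p) σ).coeff i - (FramedRep.charpoly W₁ σ).coeff i‖ < 1) ∧ ∃ ι₀ : PadicAlgCl p ≃+* ℂ, ∀ (hcptE : isCompact_glFiniteIntegralLevel 4 E), (∃ πE : CuspidalAutomorphicRepData 4 E hcptE, πE.1.IsLAlgebraic ∧ ∀ᶠ w : IsDedekindDomain.HeightOneSpectrum (NumberField.RingOfIntegers E) in Filter.cofinite, SatakeFrobCompatibleAt ι₀ πE.1 W₁ w)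

/-- item stmt-Langlands-3798 · crux · rank 4 · closed · moot by None · by planner
why it might fail: LGC at ramified v and at v=ℓ (D_pst with N) for an IRREGULAR K3-type π on GL_6/ℚ is direction-(A) information no method provides: Varma 2024 / HLTT / Scholze need regular algebraic π; eigenvariety interpolation from regular points loses the monodromy operator and F-semisimplification.
sources: VarmaFMS2024, HarrisLanTaylorThorneRMS2016, GoldringKoskivirta2019, BuzzardGeeLMS2014, Calegari2023
[crux, rank 4 — local–global compatibility everywhere] For ρ in the K3-sixteen class (same
hypotheses as the target) and an L-algebraic cuspidal π of GL_6(𝔸_ℚ) whose Satake parameters match ρ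
at all but finitely many places (SatakeFrobCompatibleAt ι π ρ v for cofinitely many v), the pair
satisfies the full `Corresponds Rd ι π ρ`: ι WD(ρ|Γ_{ℚ_v})^{F-ss} ≅ rec_v(π_v) at EVERY finite v,
including v = ℓ through D_pst. The automorphic π produced by the other cruxes is irregular at ∞ (K3
type (1,4,1): the parameter z^{-1}z̄, (zz̄)^0 ×4, z z̄^{-1} after base change), so this is
local–global compatibility of (A)-type for limit-of-discrete-series forms on GL_6/ℚ — known at v ∤ ℓ
for REGULAR algebraic π (Varma 2024, HLTT/Scholze) and essentially open in the irregular case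
(Goldring–Koskivirta give Chebotarev-density statements for LDS-attached representations;
compatibility at ℓ = p with the monodromy operator is open even for many regular cases). Why a
separate crux: BCGP-type output is Satake matching a.e.; the summit demands all places. Possible
routes: eigenvariety interpolation of LGC from regular classical points (p-adic families on U(2,2)
through the LDS point), or rigidity: strong mu -/
@[route_item "route-Langlands-K3KugaSatakeDescent"]
def LocalGlobalUpgrade : Prop :=
  ∀ (Rd : ReciprocityData ℚ) (hcpt : isCompact_glFiniteIntegralLevel 6 ℚ) (ℓ : ℕ) [Fact ℓ.Prime] (ι : PadicAlgCl ℓ ≃+* ℂ), ∀ (E : Type) [Field E] [NumberField E] [IsGalois ℚ E] [NumberField.IsTotallyComplex E], Module.finrank ℚ E = 2 → ∀ (τ : Field.absoluteGaloisGroup ℚ), τ ∉ Set.range (absGaloisRestrict ℚ E) → ∀ (ρ : FramedGaloisRep ℚ (PadicAlgCl ℓ) 6), ρ.toGaloisRep.IsIrreducible → IsGeometricFramed Rd ρ → (∃ J : Matrix (Fin 6) (Fin 6) (PadicAlgCl ℓ), J.IsSymm ∧ IsUnit J ∧ ∀ σ, ((ρ σ : GL (Fin 6) (PadicAlgCl ℓ))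 : Matrix (Fin 6) (Fin 6) (PadicAlgCl ℓ))ᵀ * J * ((ρ σ : GL (Fin 6) (PadicAlgCl ℓ)) : Matrix (Fin 6) (Fin 6) (PadicAlgCl ℓ)) = J) → (∀ σ : Field.absoluteGaloisGroup E, FramedRep.det ρ (absGaloisRestrict ℚ E σ) = 1) ∧ FramedRep.det ρ τ = -1 → (∀ (v : IsDedekindDomain.HeightOneSpectrum (NumberField.RingOfIntegers ℚ)) (hv : ((ℓ : ℕ) : NumberField.RingOfIntegers ℚ) ∈ v.asIdeal), ∃ (L : IntermediateField ℚ_[ℓ] (PadicAlgCl ℓ)) (_ : FiniteDimensional ℚ_[ℓ] L) (rL : FramedGaloisRep (v.adicCompletion ℚ) L 6), HasQlModel (ρ.toLocal v) L rL ∧ (letI := (Rd.pst ℓ v hv).algebra; (Rd.pst ℓ v hv).𝔅.hodgeTateWeights (restrictScalarsQl L rL) = Module.finrank ℚ_[ℓ] L • ({-1, 0, 0, 0, 0, 1} : Multiset ℤ))) → ∀ (bad : Finset (IsDedekindDomain.HeightOneSpectrum (NumberField.RingOfIntegers ℚ))) (P : IsDedekindDomain.HeightOneSpectrum (NumberField.RingOfIntegers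 ℚ) → Polynomial ℚ), (∀ v ∉ bad, ((ℓ : ℕ) : NumberField.RingOfIntegers ℚ) ∉ v.asIdeal → ρ.IsUnramifiedAt v ∧ ρ.HasFrobCharpolyAt v ((P v).map (algebraMap ℚ (PadicAlgCl ℓ)))) → {p : ℕ | ∃ (_ : Fact p.Prime) (r : FramedGaloisRep ℚ (PadicAlgCl p) 6), (∀ v ∉ bad, ((p : ℕ) : NumberField.RingOfIntegers ℚ) ∉ v.asIdeal → r.IsUnramifiedAt v ∧ r.HasFrobCharpolyAt v ((P v).map (algebraMap ℚ (PadicAlgCl p)))) ∧ (∃ J : Matrix (Fin 6) (Fin 6) (PadicAlgCl p), J.IsSymm ∧ IsUnit J ∧ ∀ σ, ((r σ : GL (Fin 6) (PadicAlgCl p)) : Matrix (Fin 6) (Fin 6) (PadicAlgCl p))ᵀ * J * ((r σ : GL (Fin 6) (PadicAlgCl p)) : Matrix (Fin 6) (Fin 6) (PadicAlgCl p)) = J) ∧ (∀ σ : Field.absoluteGaloisGroup E, FramedRep.det r (absGaloisRestrict ℚ E σ) = 1) ∧ FramedRep.det r τ = -1 ∧ (∀ (v : IsDedekindDomain.HeightOneSpectrum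 (NumberField.RingOfIntegers ℚ)), ((p : ℕ) : NumberField.RingOfIntegers ℚ) ∈ v.asIdeal → ∃ (g : GL (Fin 6) (PadicAlgCl p)) (U : OpenSubgroup (Field.absoluteGaloisGroup (v.adicCompletion ℚ))), (∀ (σ : Field.absoluteGaloisGroup (v.adicCompletion ℚ)) (i j : Fin 6), ((1 ≤ i.val ∧ j.val = 0) ∨ (i.val = 5 ∧ j.val ≤ 4)) → ((g * r.toLocal v σ * g⁻¹ : GL (Fin 6) (PadicAlgCl p)) : Matrix (Fin 6) (Fin 6) (PadicAlgCl p)) i j = 0) ∧ (∀ σ ∈ absInertia (v.adicCompletion ℚ), σ ∈ U → (∀ i j : Fin 6, (1 ≤ i.val ∧ i.val ≤ 4 ∧ 1 ≤ j.val ∧ j.val ≤ 4) → ((g * r.toLocal v σ * g⁻¹ : GL (Fin 6) (PadicAlgCl p)) : Matrix (Fin 6) (Fin 6) (PadicAlgCl p)) i j = if i = j then 1 else 0) ∧ ((g * r.toLocal v σ * g⁻¹ : GL (Fin 6) (PadicAlgCl p)) : Matrix (Fin 6) (Fin 6) (PadicAlgCl p)) 0 0 = algebraMap ℚ_[p] (PadicAlgCl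 p) ((GaloisRep.cyclotomicCharacter (v.adicCompletion ℚ) p σ : ℤ_[p]ˣ) : ℤ_[p]) ∧ ((g * r.toLocal v σ * g⁻¹ : GL (Fin 6) (PadicAlgCl p)) : Matrix (Fin 6) (Fin 6) (PadicAlgCl p)) 5 5 = (algebraMap ℚ_[p] (PadicAlgCl p) ((GaloisRep.cyclotomicCharacter (v.adicCompletion ℚ) p σ : ℤ_[p]ˣ) : ℤ_[p]))⁻¹)) ∧ FramedRep.IsAbsolutelyIrreducible (r.restrictField E)}.Infinite → ∀ π : CuspidalAutomorphicRepData 6 ℚ hcpt, π.1.IsLAlgebraic → (∀ᶠ v : IsDedekindDomain.HeightOneSpectrum (NumberField.RingOfIntegers ℚ) in Filter.cofinite, SatakeFrobCompatibleAt ι π.1 ρ v) → Corresponds Rd ι π.1 ρ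

/-- item stmt-Langlands-6921 · crux · rank 5 · closed · moot by None · by planner
why it might fail: At inert v only squares of Satake parameters are pinned: nothing known selects π vs π⊗η_{E/ℚ} (or excludes a mixed sign pattern) without a Galois representation r_π, unavailable for irregular π on GL_6/ℚ; BLGHT 2011 Lemmas 1.3/1.4 descend via r_π of a REGULAR form; L-function tricks stop at n≤4.
sources: BarnetlambEtAl2011, BarnetlambEtAl2014, ClozelHarrisTaylor2008, ArthurClozelAMS120, Ramakrishnan2002, Tunnell1981
[crux, rank 5 — the twist ambiguity of quadratic descent in irregular weight; second (A)-residue of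
the line] For E imaginary quadratic Galois, p, ι, and r : Γ_ℚ → GL_6(ℚ̄_p) exactly orthogonal, r|Γ_E
absolutely irreducible, unramified a.e., K3-ordinary at p: if an L-algebraic cuspidal π of GL_6(𝔸_ℚ)
has base change matching r|Γ_E a.e. (the output of WedgeSquareDescent: at almost every w ∣ v of E,
Satake parameter α of π at v ⇒ r|Γ_E unramified at w with Frobenius polynomial arithFrobPolyOfSatake
ι q_w 1 (α^{f(w|v)})), then SOME L-algebraic cuspidal π' of GL_6(𝔸_ℚ) matches r itself at almost
every place of ℚ (SatakeFrobCompatibleAt ι π' r v). Expected witness: π' ∈ {π, π ⊗ η_{E/ℚ}} — both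
descend the same Π', agree with r at split primes, and at an inert v one only knows t_{π,v}² =
t_{r,v}² elementwise; a uniform sign is forced once a Galois representation r_π with r_π|Γ_E ≅ r|Γ_E
exists (then r_π ≅ r ⊗ η^i by Clifford theory since r|Γ_E is absolutely irreducible: (A) for GL_6/ℚ
+ existence of the quadratic twist π ⊗ η ⇒ this statement, exactly as UpgradeUnderA derives
LocalGlobalUpgrade from (A)). This is the classical reason automorphy of a Galois representation
does not descend -/
@[route_item "route-Langlands-K3KugaSatakeDescent"]
def DescentSignResolution : Prop :=
  ∀ (E : Type) [Field E] [NumberField E] [IsGalois ℚ E] [NumberField.IsTotallyComplex E], Module.finrank ℚ E = 2 → ∀ (hcpt : isCompact_glFiniteIntegralLevel 6 ℚ) (p : ℕ) [Fact p.Prime] (ι : PadicAlgCl p ≃+* ℂ) (r : FramedGaloisRep ℚ (PadicAlgCl p) 6), (∃ J : Matrix (Fin 6) (Fin 6) (PadicAlgCl p), J.IsSymm ∧ IsUnit J ∧ ∀ σ, ((r σ : GL (Fin 6) (PadicAlgCl p)) : Matrix (Fin 6) (Fin 6) (PadicAlgCl p))ᵀ * J * ((r σ : GL (Fin 6) (PadicAlgCl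 p)) : Matrix (Fin 6) (Fin 6) (PadicAlgCl p)) = J) → FramedRep.IsAbsolutelyIrreducible (r.restrictField E) → (∀ᶠ w : IsDedekindDomain.HeightOneSpectrum (NumberField.RingOfIntegers ℚ) in Filter.cofinite, r.IsUnramifiedAt w) → (∀ (v : IsDedekindDomain.HeightOneSpectrum (NumberField.RingOfIntegers ℚ)), ((p : ℕ) : NumberField.RingOfIntegers ℚ) ∈ v.asIdeal → ∃ (g : GL (Fin 6) (PadicAlgCl p)) (U : OpenSubgroup (Field.absoluteGaloisGroup (v.adicCompletion ℚ))), (∀ (σ : Field.absoluteGaloisGroup (v.adicCompletion ℚ)) (i j : Fin 6), ((1 ≤ i.val ∧ j.val = 0) ∨ (i.val = 5 ∧ j.val ≤ 4)) → ((g * r.toLocal v σ * g⁻¹ : GL (Fin 6) (PadicAlgCl p)) : Matrix (Fin 6) (Fin 6) (PadicAlgCl p)) i j = 0) ∧ (∀ σ ∈ absInertia (v.adicCompletion ℚ), σ ∈ U → (∀ i j : Fin 6, (1 ≤ i.val ∧ i.val ≤ 4 ∧ 1 ≤ j.val ∧ j.val ≤ 4) → ((g * r.toLocal v σ * g⁻¹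 : GL (Fin 6) (PadicAlgCl p)) : Matrix (Fin 6) (Fin 6) (PadicAlgCl p)) i j = if i = j then 1 else 0) ∧ ((g * r.toLocal v σ * g⁻¹ : GL (Fin 6) (PadicAlgCl p)) : Matrix (Fin 6) (Fin 6) (PadicAlgCl p)) 0 0 = algebraMap ℚ_[p] (PadicAlgCl p) ((GaloisRep.cyclotomicCharacter (v.adicCompletion ℚ) p σ : ℤ_[p]ˣ) : ℤ_[p]) ∧ ((g * r.toLocal v σ * g⁻¹ : GL (Fin 6) (PadicAlgCl p)) : Matrix (Fin 6) (Fin 6) (PadicAlgCl p)) 5 5 = (algebraMap ℚ_[p] (PadicAlgCl p) ((GaloisRep.cyclotomicCharacter (v.adicCompletion ℚ) p σ : ℤ_[p]ˣ) : ℤ_[p]))⁻¹)) → ∀ π : CuspidalAutomorphicRepData 6 ℚ hcpt, π.1.IsLAlgebraic → (∀ᶠ w : IsDedekindDomain.HeightOneSpectrum (NumberField.RingOfIntegers E) in Filter.cofinite, ∀ (v : IsDedekindDomain.HeightOneSpectrum (NumberField.RingOfIntegers ℚ)) (α : Multiset ℂ), w.asIdeal.under (NumberField.RingOfIntegers ℚ)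 = v.asIdeal → π.1.HasSatakeParamAt v α → (r.restrictField E).IsUnramifiedAt w ∧ (r.restrictField E).HasFrobCharpolyAt w (arithFrobPolyOfSatake ι w.residueCard 1 (α.map (· ^ w.asIdeal.inertiaDeg (NumberField.RingOfIntegers ℚ))))) → ∃ π' : CuspidalAutomorphicRepData 6 ℚ hcpt, π'.1.IsLAlgebraic ∧ ∀ᶠ v : IsDedekindDomain.HeightOneSpectrum (NumberField.RingOfIntegers ℚ) in Filter.cofinite, SatakeFrobCompatibleAt ι π'.1 r v

/-- item stmt-Langlands-3799 · support · rank 9 · closed · moot by None · by planner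
sources: Kim2002, ArthurClozelAMS120, BuzzardGeeLMS2014
[support — closing the loop, Kim Λ² + Arthur–Clozel descent read on the Galois side; antecedent =
the tree's named fact Literature.NumberTheory.Automorphic.cuspidal_descent_cyclic (Arthur–Clozel
III.4.2(d), RepData model)] For E imaginary quadratic Galois, r : Γ_ℚ → GL_6(ℚ̄_p) with r|Γ_E
absolutely irreducible, unramified a.e., K3-ordinary at p (hence de Rham: this hypothesis is what
makes the statement true — without it a wild twist r ⊗ ε^s would satisfy the remaining hypotheses),
and W : Γ_E → GL_4(ℚ̄_p) automorphic (Satake matching a.e. with L-algebraic cuspidal Π on GL_4/E)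
with Λ²W ≅ ν ⊗ r|Γ_E (trace identity): then r is weakly automorphic on GL_6/ℚ (∃ L-algebraic
cuspidal π with Satake matching a.e.). Proof plan: Kim2002 gives the automorphic Λ²Π on GL_6(𝔸_E)
(cuspidal unless Π is of orthogonal/symplectic/induced/Sym³ type — excluded here since Λ²W ≅ ν ⊗
r|Γ_E is irreducible); ν corresponds to an algebraic Hecke character (ν is de Rham as a constituent
of Hom(r|Γ_E, Λ²W)); Λ²Π ⊗ (ν∘Art)⁻¹ is Gal(E/ℚ)-stable (its Satake data come from r, a
Γ_ℚ-representation), so Arthur–Clozel Thm III.4.2(d) (tree: ArthurClozel1989_cuspidal_descent,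
CuspidalDescentCyclicRepData) descends it to -/
@[route_item "route-Langlands-K3KugaSatakeDescent"]
def WedgeSquareDescent : Prop :=
  cuspidal_descent_cyclic → ∀ (E : Type) [Field E] [NumberField E] [IsGalois ℚ E] [NumberField.IsTotallyComplex E], Module.finrank ℚ E = 2 → ∀ (τ : Field.absoluteGaloisGroup ℚ), τ ∉ Set.range (absGaloisRestrict ℚ E) → ∀ (hcptE : isCompact_glFiniteIntegralLevel 4 E) (hcpt : isCompact_glFiniteIntegralLevel 6 ℚ) (p : ℕ) [Fact p.Prime] (ι : PadicAlgCl p ≃+* ℂ) (r : FramedGaloisRep ℚ (PadicAlgCl p) 6) (W : FramedGaloisRep E (PadicAlgCl p) 4), FramedRep.IsAbsolutelyIrreducible (r.restrictField E) → (∀ᶠ w : IsDedekindDomain.HeightOneSpectrum (NumberField.RingOfIntegers ℚ) in Filter.cofinite, r.IsUnramifiedAt w) → (∀ (v : IsDedekindDomain.HeightOneSpectrum (NumberField.RingOfIntegers ℚ)), ((p : ℕ) : NumberField.RingOfIntegers ℚ) ∈ v.asIdeal → ∃ (g : GL (Fin 6) (PadicAlgCl p)) (U : OpenSubgroup (Field.absoluteGaloisGroup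 (v.adicCompletion ℚ))), (∀ (σ : Field.absoluteGaloisGroup (v.adicCompletion ℚ)) (i j : Fin 6), ((1 ≤ i.val ∧ j.val = 0) ∨ (i.val = 5 ∧ j.val ≤ 4)) → ((g * r.toLocal v σ * g⁻¹ : GL (Fin 6) (PadicAlgCl p)) : Matrix (Fin 6) (Fin 6) (PadicAlgCl p)) i j = 0) ∧ (∀ σ ∈ absInertia (v.adicCompletion ℚ), σ ∈ U → (∀ i j : Fin 6, (1 ≤ i.val ∧ i.val ≤ 4 ∧ 1 ≤ j.val ∧ j.val ≤ 4) → ((g * r.toLocal v σ * g⁻¹ : GL (Fin 6) (PadicAlgCl p)) : Matrix (Fin 6) (Fin 6) (PadicAlgCl p)) i j = if i = j then 1 else 0) ∧ ((g * r.toLocal v σ * g⁻¹ : GL (Fin 6) (PadicAlgCl p)) : Matrix (Fin 6) (Fin 6) (PadicAlgCl p)) 0 0 = algebraMap ℚ_[p] (PadicAlgCl p) ((GaloisRep.cyclotomicCharacter (v.adicCompletion ℚ) p σ : ℤ_[p]ˣ) : ℤ_[p]) ∧ ((g * r.toLocal v σ * g⁻¹ : GL (Fin 6) (PadicAlgCl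 p)) : Matrix (Fin 6) (Fin 6) (PadicAlgCl p)) 5 5 = (algebraMap ℚ_[p] (PadicAlgCl p) ((GaloisRep.cyclotomicCharacter (v.adicCompletion ℚ) p σ : ℤ_[p]ˣ) : ℤ_[p]))⁻¹)) → (∃ ν : Field.absoluteGaloisGroup E →ₜ* (PadicAlgCl p)ˣ, ∀ σ : Field.absoluteGaloisGroup E, (ν σ : PadicAlgCl p) * FramedRep.trace r (absGaloisRestrict ℚ E σ) = ((FramedRep.trace W σ) ^ 2 - FramedRep.trace W (σ * σ)) / 2) → (∃ πE : CuspidalAutomorphicRepData 4 E hcptE, πE.1.IsLAlgebraic ∧ ∀ᶠ w : IsDedekindDomain.HeightOneSpectrum (NumberField.RingOfIntegers E) in Filter.cofinite, SatakeFrobCompatibleAt ι πE.1 W w) → ∃ π : CuspidalAutomorphicRepData 6 ℚ hcpt, π.1.IsLAlgebraic ∧ ∀ᶠ v : IsDedekindDomain.HeightOneSpectrum (NumberField.RingOfIntegers ℚ) in Filter.cofinite, SatakeFrobCompatibleAt ι π.1 r v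

/-- item stmt-Langlands-3800 · support · rank 9 · closed · moot by None · by planner
sources: Patrikis2019, Vangeemen2023, Lombardo2001
[support — the D_3 = A_3 dictionary with local transfer] For E imaginary quadratic Galois, τ ∉
res(Γ_E), p ≠ 2, and r : Γ_ℚ → GL_6(ℚ̄_p) exactly orthogonal with det r|Γ_E = 1, det r(τ) = −1,
K3-ordinary at p, r|Γ_E absolutely irreducible, unramified a.e.: there is W : Γ_E → GL_4(ℚ̄_p) with
Λ²W ≅ ν ⊗ r|Γ_E (trace identity), W absolutely irreducible, τ-polarized (tr W^τ(σ) = χ(σ) tr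
W(σ⁻¹)), weight-{0,0,1,1} (potentially) ordinary at every w ∣ p, unramified a.e. Proof plan: r|Γ_E
lands in SO_6(ℚ̄_p) = SL_4/±1 acting on Λ²; Tate's vanishing of H²(Γ_E, ℚ̄_p^×) (Patrikis2019 §2 for
the ℓ-adic/geometric refinement) lifts the projective representation Γ_E → PSO_6 = PGL_4 to W with
Λ²W ≅ ν ⊗ r|Γ_E; for σ₀ = τ, r(τ) ∈ O_6 ∖ SO_6 induces the OUTER automorphism of PGL_4, whence W^τ ≅
W^∨ ⊗ χ (this is where odd determinant = polarized; in the even sector W extends to Γ_ℚ and is not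
essentially self-dual); irreducibility: a Γ_E-stable subspace of W makes Λ²W reducible; ordinarity:
the (1,4,1) parabolic of SO_6 pulls back to the (2,2) parabolic of GL_4 (isotropic line =
decomposable 2-vector = 2-plane), and the inertial characters a, b of the two blocks satisfy a = bε,
so after a global twist (f -/
@[route_item "route-Langlands-K3KugaSatakeDescent"]
def SpinAvatar : Prop :=
  ∀ (E : Type) [Field E] [NumberField E] [IsGalois ℚ E] [NumberField.IsTotallyComplex E], Module.finrank ℚ E = 2 → ∀ (τ : Field.absoluteGaloisGroup ℚ), τ ∉ Set.range (absGaloisRestrict ℚ E) → ∀ (p : ℕ) [Fact p.Prime], p ≠ 2 → ∀ (r : FramedGaloisRep ℚ (PadicAlgCl p) 6), (∃ J : Matrix (Fin 6) (Fin 6) (PadicAlgCl p), J.IsSymm ∧ IsUnit J ∧ ∀ σ, ((r σ : GL (Fin 6) (PadicAlgCl p)) : Matrix (Fin 6) (Fin 6) (PadicAlgCl p))ᵀ * J * ((r σ : GL (Fin 6) (PadicAlgCl p)) : Matrix (Fin 6) (Fin 6) (PadicAlgCl p)) = J) → (∀ σ : Field.absoluteGaloisGroup E, FramedRep.det r (absGaloisRestrict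 ℚ E σ) = 1) ∧ FramedRep.det r τ = -1 → (∀ (v : IsDedekindDomain.HeightOneSpectrum (NumberField.RingOfIntegers ℚ)), ((p : ℕ) : NumberField.RingOfIntegers ℚ) ∈ v.asIdeal → ∃ (g : GL (Fin 6) (PadicAlgCl p)) (U : OpenSubgroup (Field.absoluteGaloisGroup (v.adicCompletion ℚ))), (∀ (σ : Field.absoluteGaloisGroup (v.adicCompletion ℚ)) (i j : Fin 6), ((1 ≤ i.val ∧ j.val = 0) ∨ (i.val = 5 ∧ j.val ≤ 4)) → ((g * r.toLocal v σ * g⁻¹ : GL (Fin 6) (PadicAlgCl p)) : Matrix (Fin 6) (Fin 6) (PadicAlgCl p)) i j = 0) ∧ (∀ σ ∈ absInertia (v.adicCompletion ℚ), σ ∈ U → (∀ i j : Fin 6, (1 ≤ i.val ∧ i.val ≤ 4 ∧ 1 ≤ j.val ∧ j.val ≤ 4) → ((g * r.toLocal v σ * g⁻¹ : GL (Fin 6) (PadicAlgCl p)) : Matrix (Fin 6) (Fin 6) (PadicAlgCl p)) i j = if i = j then 1 else 0) ∧ ((g * r.toLocal v σ * g⁻¹ : GL (Fin 6) (PadicAlgCl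 p)) : Matrix (Fin 6) (Fin 6) (PadicAlgCl p)) 0 0 = algebraMap ℚ_[p] (PadicAlgCl p) ((GaloisRep.cyclotomicCharacter (v.adicCompletion ℚ) p σ : ℤ_[p]ˣ) : ℤ_[p]) ∧ ((g * r.toLocal v σ * g⁻¹ : GL (Fin 6) (PadicAlgCl p)) : Matrix (Fin 6) (Fin 6) (PadicAlgCl p)) 5 5 = (algebraMap ℚ_[p] (PadicAlgCl p) ((GaloisRep.cyclotomicCharacter (v.adicCompletion ℚ) p σ : ℤ_[p]ˣ) : ℤ_[p]))⁻¹)) → FramedRep.IsAbsolutelyIrreducible (r.restrictField E) → (∀ᶠ w : IsDedekindDomain.HeightOneSpectrum (NumberField.RingOfIntegers ℚ) in Filter.cofinite, r.IsUnramifiedAt w) → ∃ W : FramedGaloisRep E (PadicAlgCl p) 4, (∃ ν : Field.absoluteGaloisGroup E →ₜ* (PadicAlgCl p)ˣ, ∀ σ : Field.absoluteGaloisGroup E, (ν σ : PadicAlgCl p) * FramedRep.trace r (absGaloisRestrict ℚ E σ) = ((FramedRep.trace W σ) ^ 2 - FramedRep.trace W (σ * σ)) / 2) ∧ FramedRep.IsAbsolutelyIrreducible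 W ∧ (∃ χ : Field.absoluteGaloisGroup E →ₜ* (PadicAlgCl p)ˣ, ∀ σ, FramedRep.trace (FramedGaloisRep.outerConj τ W) σ = (χ σ : PadicAlgCl p) * FramedRep.trace W σ⁻¹) ∧ (∀ (w : IsDedekindDomain.HeightOneSpectrum (NumberField.RingOfIntegers E)), ((p : ℕ) : NumberField.RingOfIntegers E) ∈ w.asIdeal → ∃ (g : GL (Fin 4) (PadicAlgCl p)) (U : OpenSubgroup (Field.absoluteGaloisGroup (w.adicCompletion E))), (∀ (σ : Field.absoluteGaloisGroup (w.adicCompletion E)) (i j : Fin 4), (2 ≤ i.val ∧ j.val ≤ 1) → ((g * W.toLocal w σ * g⁻¹ : GL (Fin 4) (PadicAlgCl p)) : Matrix (Fin 4) (Fin 4) (PadicAlgCl p)) i j = 0) ∧ (∀ σ ∈ absInertia (w.adicCompletion E), σ ∈ U → ∀ i j : Fin 4, ((i.val ≤ 1 ∧ j.val ≤ 1) → ((g * W.toLocal w σ * g⁻¹ : GL (Fin 4) (PadicAlgCl p)) : Matrix (Fin 4) (Fin 4) (PadicAlgCl p)) i j = if i = j then 1 else 0) ∧ ((2 ≤ i.val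 ∧ 2 ≤ j.val) → ((g * W.toLocal w σ * g⁻¹ : GL (Fin 4) (PadicAlgCl p)) : Matrix (Fin 4) (Fin 4) (PadicAlgCl p)) i j = if i = j then (algebraMap ℚ_[p] (PadicAlgCl p) ((GaloisRep.cyclotomicCharacter (w.adicCompletion E) p σ : ℤ_[p]ˣ) : ℤ_[p]))⁻¹ else 0))) ∧ (∀ᶠ w : IsDedekindDomain.HeightOneSpectrum (NumberField.RingOfIntegers E) in Filter.cofinite, W.IsUnramifiedAt w)

/-- item stmt-Langlands-3801 · support · rank 9 · closed · moot by None · by planner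
sources: Patrikis2019, Vangeemen2023, Calegari2023
[support — the wall of the province, pure Galois theory] For r : Γ_ℚ → GL_6(ℚ̄_p) exactly orthogonal
with det r = 1 (EVEN sector) and absolutely irreducible: (i) a spin lift exists already over ℚ —
some W : Γ_ℚ → GL_4(ℚ̄_p) and character ν with Λ²W ≅ ν ⊗ r (trace identity; Tate's lifting theorem
over ℚ through PSO_6 = PGL_4), and (ii) NO such W is essentially self-dual (for every χ the trace
identity tr W(σ) = χ(σ) tr W(σ⁻¹) fails somewhere): an essentially self-dual W is GSp_4- or
GO_4-valued and then Λ²W is reducible (1 ⊕ 5 or 3 ⊕ 3), contradicting irreducibility of r.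
Consequently for even-determinant K3 motives (e.g. Weil-type fourfolds whose E-action is defined
over ℚ, or K3/ℚ of rank 16 with det ρ_T(c) = +1) the restriction of W to any imaginary quadratic
field is not polarized and the U(2,2) mechanism has no host: this is the sector correction of the
card, filed so that refuters and planners of neighbouring routes (QuadraticWindow, GSpinRung) can
cite a proved statement. -/
@[route_item "route-Langlands-K3KugaSatakeDescent"]
def EvenSectorNotPolarized : Prop :=
  ∀ (p : ℕ) [Fact p.Prime] (r : FramedGaloisRep ℚ (PadicAlgCl p) 6), (∃ J : Matrix (Fin 6) (Fin 6) (PadicAlgCl p), J.IsSymm ∧ IsUnit J ∧ ∀ σ, ((r σ : GL (Fin 6) (PadicAlgCl p)) : Matrix (Fin 6) (Fin 6) (PadicAlgCl p))ᵀ * J * ((r σ : GL (Fin 6) (PadicAlgCl p)) : Matrix (Fin 6) (Fin 6) (PadicAlgCl p)) = J) → (∀ σ : Field.absoluteGaloisGroup ℚ, FramedRep.det r σ = 1) → FramedRep.IsAbsolutelyIrreducible r → (∃ W : FramedGaloisRep ℚ (PadicAlgCl p) 4, (∃ ν : Field.absoluteGaloisGroup ℚ →ₜ* (PadicAlgCl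 p)ˣ, ∀ σ : Field.absoluteGaloisGroup ℚ, (ν σ : PadicAlgCl p) * FramedRep.trace r σ = ((FramedRep.trace W σ) ^ 2 - FramedRep.trace W (σ * σ)) / 2)) ∧ ∀ W : FramedGaloisRep ℚ (PadicAlgCl p) 4, (∃ ν : Field.absoluteGaloisGroup ℚ →ₜ* (PadicAlgCl p)ˣ, ∀ σ : Field.absoluteGaloisGroup ℚ, (ν σ : PadicAlgCl p) * FramedRep.trace r σ = ((FramedRep.trace W σ) ^ 2 - FramedRep.trace W (σ * σ)) / 2) → ∀ χ : Field.absoluteGaloisGroup ℚ →ₜ* (PadicAlgCl p)ˣ, ¬ (∀ σ : Field.absoluteGaloisGroup ℚ, FramedRep.trace W σ = (χ σ : PadicAlgCl p) * FramedRep.trace W σ⁻¹)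

/-- item stmt-Langlands-3802 · support · rank 9 · closed · moot by None · by planner
sources: BuzzardGeeLMS2014, HarrisLanTaylorThorneRMS2016
[support — glue: crux LocalGlobalUpgrade is the (A)-residue] If Rd satisfies direction (A) for n = 6
over ℚ (AutomorphicToGalois 6 Rd hcpt), then for every irreducible ρ : Γ_ℚ → GL_6(ℚ̄_ℓ) and every
L-algebraic cuspidal π with Satake–Frobenius matching at cofinitely many places, Corresponds Rd ι π
ρ. Proof: (A) gives an irreducible ρ_π with Corresponds Rd ι π ρ_π; ρ and ρ_π have equal Frobenius
characteristic polynomials at cofinitely many places (HasFrobCharpolyAt.unique_holds), hence are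
isomorphic (Chebotarev + Brauer–Nesbitt:
FramedGaloisRep.nonempty_equiv_of_hasFrobCharpolyAt_eventually, chebotarev_artinRep_holds;
FramedRepEquivConj gives a conjugating g), and Corresponds is invariant under FramedRep.conj
(PstWeilDeligneData.conj, IsWeilDeligneOfLadic and HasFrobCharpolyAt are frame-invariant). Hence (∀
Rd hcpt, AutomorphicToGalois 6 Rd hcpt) → LocalGlobalUpgrade, and WeakProvince + (A)₆ →
K3SixteenProvince. -/
@[route_item "route-Langlands-K3KugaSatakeDescent"]
def UpgradeUnderA : Prop :=
  ∀ (Rd : ReciprocityData ℚ) (hcpt : isCompact_glFiniteIntegralLevel 6 ℚ), AutomorphicToGalois 6 Rd hcpt → ∀ (ℓ : ℕ) [Fact ℓ.Prime] (ι : PadicAlgCl ℓ ≃+* ℂ) (ρ : FramedGaloisRep ℚ (PadicAlgCl ℓ) 6), ρ.toGaloisRep.IsIrreducible → ∀ π : CuspidalAutomorphicRepData 6 ℚ hcpt, π.1.IsLAlgebraic → (∀ᶠ v : IsDedekindDomain.HeightOneSpectrum (NumberField.RingOfIntegers ℚ) in Filter.cofinite, SatakeFrobCompatibleAt ι π.1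 ρ v) → Corresponds Rd ι π.1 ρ

/-- item stmt-Langlands-3803 · support · rank 9 · closed · moot by None · by planner
sources: BoxerEtAl2021
[support — weak form of the target] Same hypotheses as K3SixteenProvince; conclusion: an L-algebraic
cuspidal π of GL_6(𝔸_ℚ) with Satake–Frobenius matching at all but finitely many places (the
BCGP-type output). Follows from SpinAvatar + SerreTypeAnchor + DoubledWeightLifting +
WedgeSquareDescent by the glue of the Assembly (choose an odd prime in the infinite ordinary set,
transfer Satake matching from the companion r_p to ρ through the rational polynomials P(v):
HasFrobCharpolyAt.unique_holds, hasSatakeParamAt uniqueness, polynomial root bookkeeping).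
WeakProvince ∧ LocalGlobalUpgrade → K3SixteenProvince is immediate. -/
@[route_item "route-Langlands-K3KugaSatakeDescent"]
def WeakProvince : Prop :=
  ∀ (Rd : ReciprocityData ℚ) (hcpt : isCompact_glFiniteIntegralLevel 6 ℚ) (ℓ : ℕ) [Fact ℓ.Prime] (ι : PadicAlgCl ℓ ≃+* ℂ), ∀ (E : Type) [Field E] [NumberField E] [IsGalois ℚ E] [NumberField.IsTotallyComplex E], Module.finrank ℚ E = 2 → ∀ (τ : Field.absoluteGaloisGroup ℚ), τ ∉ Set.range (absGaloisRestrict ℚ E) → ∀ (ρ : FramedGaloisRep ℚ (PadicAlgCl ℓ) 6), ρ.toGaloisRep.IsIrreducible → IsGeometricFramed Rd ρ → (∃ J : Matrix (Fin 6) (Fin 6) (PadicAlgCl ℓ), J.IsSymm ∧ IsUnit J ∧ ∀ σ, ((ρ σ : GL (Fin 6) (PadicAlgCl ℓ)) : Matrix (Fin 6) (Fin 6) (PadicAlgCl ℓ))ᵀ * J * ((ρ σ : GL (Fin 6) (PadicAlgCl ℓ)) : Matrix (Fin 6) (Fin 6) (PadicAlgCl ℓ)) = J) → (∀ σ : Field.absoluteGaloisGroup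 E, FramedRep.det ρ (absGaloisRestrict ℚ E σ) = 1) ∧ FramedRep.det ρ τ = -1 → (∀ (v : IsDedekindDomain.HeightOneSpectrum (NumberField.RingOfIntegers ℚ)) (hv : ((ℓ : ℕ) : NumberField.RingOfIntegers ℚ) ∈ v.asIdeal), ∃ (L : IntermediateField ℚ_[ℓ] (PadicAlgCl ℓ)) (_ : FiniteDimensional ℚ_[ℓ] L) (rL : FramedGaloisRep (v.adicCompletion ℚ) L 6), HasQlModel (ρ.toLocal v) L rL ∧ (letI := (Rd.pst ℓ v hv).algebra; (Rd.pst ℓ v hv).𝔅.hodgeTateWeights (restrictScalarsQl L rL) = Module.finrank ℚ_[ℓ] L • ({-1, 0, 0, 0, 0, 1} : Multiset ℤ))) → ∀ (bad : Finset (IsDedekindDomain.HeightOneSpectrum (NumberField.RingOfIntegers ℚ))) (P : IsDedekindDomain.HeightOneSpectrum (NumberField.RingOfIntegers ℚ) → Polynomial ℚ), (∀ v ∉ bad, ((ℓ : ℕ) : NumberField.RingOfIntegers ℚ) ∉ v.asIdeal → ρ.IsUnramifiedAt v ∧ ρ.HasFrobCharpolyAt v ((P v).map (algebraMap ℚ (PadicAlgCl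 ℓ)))) → {p : ℕ | ∃ (_ : Fact p.Prime) (r : FramedGaloisRep ℚ (PadicAlgCl p) 6), (∀ v ∉ bad, ((p : ℕ) : NumberField.RingOfIntegers ℚ) ∉ v.asIdeal → r.IsUnramifiedAt v ∧ r.HasFrobCharpolyAt v ((P v).map (algebraMap ℚ (PadicAlgCl p)))) ∧ (∃ J : Matrix (Fin 6) (Fin 6) (PadicAlgCl p), J.IsSymm ∧ IsUnit J ∧ ∀ σ, ((r σ : GL (Fin 6) (PadicAlgCl p)) : Matrix (Fin 6) (Fin 6) (PadicAlgCl p))ᵀ * J * ((r σ : GL (Fin 6) (PadicAlgCl p)) : Matrix (Fin 6) (Fin 6) (PadicAlgCl p)) = J) ∧ (∀ σ : Field.absoluteGaloisGroup E, FramedRep.det r (absGaloisRestrict ℚ E σ) = 1) ∧ FramedRep.det r τ = -1 ∧ (∀ (v : IsDedekindDomain.HeightOneSpectrum (NumberField.RingOfIntegers ℚ)), ((p : ℕ) : NumberField.RingOfIntegers ℚ) ∈ v.asIdeal → ∃ (g : GL (Fin 6) (PadicAlgCl p)) (U : OpenSubgroup (Field.absoluteGaloisGroup (v.adicCompletion ℚ))),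 (∀ (σ : Field.absoluteGaloisGroup (v.adicCompletion ℚ)) (i j : Fin 6), ((1 ≤ i.val ∧ j.val = 0) ∨ (i.val = 5 ∧ j.val ≤ 4)) → ((g * r.toLocal v σ * g⁻¹ : GL (Fin 6) (PadicAlgCl p)) : Matrix (Fin 6) (Fin 6) (PadicAlgCl p)) i j = 0) ∧ (∀ σ ∈ absInertia (v.adicCompletion ℚ), σ ∈ U → (∀ i j : Fin 6, (1 ≤ i.val ∧ i.val ≤ 4 ∧ 1 ≤ j.val ∧ j.val ≤ 4) → ((g * r.toLocal v σ * g⁻¹ : GL (Fin 6) (PadicAlgCl p)) : Matrix (Fin 6) (Fin 6) (PadicAlgCl p)) i j = if i = j then 1 else 0) ∧ ((g * r.toLocal v σ * g⁻¹ : GL (Fin 6) (PadicAlgCl p)) : Matrix (Fin 6) (Fin 6) (PadicAlgCl p)) 0 0 = algebraMap ℚ_[p] (PadicAlgCl p) ((GaloisRep.cyclotomicCharacter (v.adicCompletion ℚ) p σ : ℤ_[p]ˣ) : ℤ_[p]) ∧ ((g * r.toLocal v σ * g⁻¹ : GL (Fin 6) (PadicAlgCl p)) : Matrix (Fin 6)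 (Fin 6) (PadicAlgCl p)) 5 5 = (algebraMap ℚ_[p] (PadicAlgCl p) ((GaloisRep.cyclotomicCharacter (v.adicCompletion ℚ) p σ : ℤ_[p]ˣ) : ℤ_[p]))⁻¹)) ∧ FramedRep.IsAbsolutelyIrreducible (r.restrictField E)}.Infinite → ∃ π : CuspidalAutomorphicRepData 6 ℚ hcpt, π.1.IsLAlgebraic ∧ ∀ᶠ v : IsDedekindDomain.HeightOneSpectrum (NumberField.RingOfIntegers ℚ) in Filter.cofinite, SatakeFrobCompatibleAt ι π.1 ρ v

/-- item stmt-Langlands-3804 · support · rank 9 · closed · moot by None · by planner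
sources: BuzzardGeeLMS2014
[support — restriction certificate] (∀ Rd hcpt, GaloisToAutomorphic 6 Rd hcpt) → K3SixteenProvince:
the target is conjunct (B) for n = 6 over ℚ with extra hypotheses on ρ and nothing else (one-line
proof: instantiate and discard hypotheses). Certifies that the province is typed inside the summit's
own language and vacuity profile. -/
@[route_item "route-Langlands-K3KugaSatakeDescent"]
def ProvinceOfSummit : Prop :=
  (∀ (Rd : ReciprocityData ℚ) (hcpt : isCompact_glFiniteIntegralLevel 6 ℚ), GaloisToAutomorphic 6 Rd hcpt) → K3SixteenProvince

/-- item stmt-Langlands-6889 · support · rank 9 · closed · moot by None · by planner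
[support — literature input, route-local shadow of a named fact; needs-fact:
Literature.NumberTheory.Automorphic.cuspidal_descent_cyclic] QUADRATIC CUSPIDAL DESCENT OVER ℚ FOR
GL_n (Arthur–Clozel, Ann. of Math. Stud. 120 (1989), Ch. 3, Thm. 4.2 (d) existence clause + Thm. 5.1
/ Ch. 1 §7 for the archimedean place; Langlands1980 for n = 2): for E/ℚ quadratic Galois and Π
cuspidal on GL_n(𝔸_E) (Borel–Jacquet datum CuspidalAutomorphicRepData, hypotheses hQ, hE typing the
automorphy data as in the summit) whose Satake data are Gal(E/ℚ)-stable at almost every place (the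
a.e. shadow of Π ≅ Π ∘ σ, equivalent to it by strong multiplicity one), there is a cuspidal π on
GL_n(𝔸_ℚ) of which Π is a weak base-change lift — t_{Π,w} = t_{π,v}^{f(w|v)} for almost all w ∣ v —
and π is L-algebraic when Π is (archimedean Shintani relation: φ_{Π_∞} = φ_{π_∞}|_{W_ℂ}, and
L-algebraicity only reads the restriction to ℂ^×, BuzzardGeeLMS2014 Def. 3.1.1). The first conjunct
is VERBATIM the case F = ℚ, [E:F] = 2 of the tree's named fact
`Literature.NumberTheory.Automorphic.cuspidal_descent_cyclic` (TunnellOctahedralGlobal;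
IsGaloisStableSatakeAE / IsWeakBaseChangeLiftAE unfolded; IsCyclic and primality of the -/
@[route_item "route-Langlands-K3KugaSatakeDescent"]
def QuadraticDescentGLn : Prop :=
  ∀ (n : ℕ) (E : Type) [Field E] [NumberField E] [IsGalois ℚ E], Module.finrank ℚ E = 2 → ∀ (hQ : isCompact_glFiniteIntegralLevel n ℚ) (hE : isCompact_glFiniteIntegralLevel n E) (P : CuspidalAutomorphicRepData n E hE), (∀ᶠ w : IsDedekindDomain.HeightOneSpectrum (NumberField.RingOfIntegers E) in Filter.cofinite, ∀ w' : IsDedekindDomain.HeightOneSpectrum (NumberField.RingOfIntegers E), w'.asIdeal.under (NumberField.RingOfIntegers ℚ) = w.asIdeal.under (NumberField.RingOfIntegers ℚ) → ∀ α : Multiset ℂ, P.1.HasSatakeParamAt w α → P.1.HasSatakeParamAt w' α) → ∃ π : CuspidalAutomorphicRepData n ℚ hQ, (∀ᶠ w : IsDedekindDomain.HeightOneSpectrum (NumberField.RingOfIntegers E) in Filter.cofinite, ∀ (v : IsDedekindDomain.HeightOneSpectrum (NumberField.RingOfIntegers ℚ)) (α : Multiset ℂ), w.asIdeal.under (NumberField.RingOfIntegers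 ℚ) = v.asIdeal → π.1.HasSatakeParamAt v α → P.1.HasSatakeParamAt w (α.map (· ^ w.asIdeal.inertiaDeg (NumberField.RingOfIntegers ℚ)))) ∧ (P.1.IsLAlgebraic → π.1.IsLAlgebraic)

/-- item stmt-Langlands-3805 · assembly · rank 1 · closed · moot by None · by planner
sources: BoxerEtAl2021
[assembly] SpinAvatar → SerreTypeAnchor → DoubledWeightLifting → WedgeSquareDescent →
LocalGlobalUpgrade → K3SixteenProvince — with the tree's named fact cuspidal_descent_cyclic
(Arthur–Clozel III.4.2(d)) as leading antecedent, because WedgeSquareDescent carries it as its own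
hypothesis (BSD-route pattern: Literature facts enter assemblies as antecedents). Proof sketch (real
but elementary glue): from the class of ρ take (bad, P) and the infinite set S of primes with
ordinary companions; S ∖ {2} is infinite; for p ∈ S ∖ {2} choose r_p and, by SpinAvatar (with the
class's E, τ), an avatar W_p; package them as families rf, Wf (junk = trivial representation off S);
SerreTypeAnchor yields p₀, W₁, ι₀ with W₁ automorphic and congruent; DoubledWeightLifting gives
automorphy of W_{p₀} (hcptE from isCompact_glFiniteIntegralLevel_holds); WedgeSquareDescent gives π
on GL_6/ℚ matching r_{p₀} a.e. via ι₀; the rational polynomials P(v) transport Satake–Frobenius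
matching from (r_{p₀}, ι₀) to (ρ, ι) at cofinitely many v (HasFrobCharpolyAt.unique_holds, roots of
arithFrobPolyOfSatake, hasSatakeParamAt uniqueness, finiteness of places above p₀ and ℓ);
LocalGlobalUpgrade upgrades to Corresponds. -/
@[route_item "route-Langlands-K3KugaSatakeDescent"]
def Assembly : Prop :=
  cuspidal_descent_cyclic → SpinAvatar → SerreTypeAnchor → DoubledWeightLifting → WedgeSquareDescent → LocalGlobalUpgrade → K3SixteenProvince

end Summit.Langlands.Langlands.Theses.K3KugaSatakeDescent
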